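/-
Copyright (c) 2026 the pub-hodgecm-mathlib formalisation cell (harness21).  Prover seat hodgecm-mathlib-K2Liu-p14 (g2): Track B «K2-LIT»,
hLiu418 = stmt-HodgeConjecture-24832; K2E5-plan (g7) 10:32:10Z «(β4-v) IS YOURS» (LEAD F0P6-plan lineage RULING M-157b (β4)), file (β4-v) D2a.
-/
import Summits.HodgeConjecture.HodgeConjecture.Theorems.K2LiuGL2GodementFiniteAdelicShell   -- ★ (β4-i)
import Literature.NumberTheory.Automorphic.AdelicGLnGlue                                   -- ★ `GLn.ofInfinite`, `GLn.commute_ofInfinite_ofFinite`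
import Literature.NumberTheory.Automorphic.ReductionTheoryGLn                              -- ★ `standardMaximalCompactGL`
import Mathlib.LinearAlgebra.UnitaryGroup
import HarnessLib

/-!
# Crux `HLiu418`, road `K2_Liu`, Road Φ organ G5 (β) «Godement sections exhaust», file (β4-v) D2a:
# THE FINITE-ADELIC COEFFICIENTS `βf(k_f) = Σ_x c(x) · B(ι_∞ x · ι_f k_f)` OF A FLAT LEVEL-`K′_f` FUNCTION `B` ON `K` AND THEIR SCHWARTZ–BRUHAT DATA

Cell `hodgecm-mathlib`, crux item hLiu418 = `stmt-HodgeConjecture-24832`; prover K2Liu-p14 (g2).  THEOREMS ONLY (no `def`, no instance, no notation,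
no named-fact hypothesis, no `sorry`); lane `--supports stmt-HodgeConjecture-24832` (count-neutral helper).  GENERIC number field `L`.
For `B : GL₂(𝔸_L) → ℂ` left-invariant under the upper-triangular elements of `K = K_∞·GL₂(𝒪̂_L)` on `K` (`hBK`) and right-invariant on `K` under the level
`K′_f = ∏_{v∈S} K_{γ_v} × ∏_{v∉S} GL₂(𝒪_v)` (`hlev`), and ANY finite combination of archimedean evaluation points `c : U(2, mixedSpace L) →₀ ℂ` (the
coordinate functionals of ★ (β4-v) D1), the finite-adelic coefficient `βf(k_f) := Σ_x c(x) · B(ι_∞ x · ι_f k_f)` (`ι_∞ =` ★ `GLn.ofInfinite` on the unit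
`⟨x, xᴴ⟩`, `ι_f =` ★ `GLn.ofFinite`) inherits both invariances (`betaFin_borel_mul`, `betaFin_mul_level`), hence — read on `S`-tuples through the section
`t ↦ (GLn.restrictedPiEquiv 2 L).symm (t on S, 1 off S)` (§2) — satisfies the hypotheses `hB`∕`hlev` of ★ (β4-i)
`K2LiuGL2GodementFiniteAdelicShell.exists_finiteAdelic_schwartzBruhat_of_flat`: MAIN **`exists_finiteAdelic_schwartzBruhat_of_flat_combination`** —
`∃ Φf ∈ SchwartzBruhat((𝔸_L^∞)²)`, `Φf(a_f · e₂ k_f) = 𝟙_D(a) · βf(k_f)` on `GL₂(𝒪̂_L)`, VERBATIM the `hfin` face of ★ (β4-iii) `exists_godement_exhaust`.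
[cite: JacquetLanglands1970, §3, §11] [cite: Bump1997, §3.7] [cite: BorelJacquet1979, §4.1] [cite: CogdellAnalyticTheory2004, §2.3].
HONEST LABEL.  `HC_CM` is proved only modulo the 7 printed citations (2 remaining named inputs: hLiu418 = `stmt-HodgeConjecture-24832`,
h413 = `stmt-HodgeConjecture-24833`) until rung 0 closes.
-/

set_option autoImplicit false
set_option linter.dupNamespace false -- the mandated namespace repeats `HodgeConjecture.HodgeConjecture`

noncomputable section

open NumberField NumberField.InfinitePlace NumberField.mixedEmbedding IsDedekindDomain Filter
open scoped Classical Matrix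
open Literature.NumberTheory.Automorphic
open Literature.NumberTheory.GaloisRepresentations (ideleGroup)
open Summit.HodgeConjecture.HodgeConjecture.Cruxes.HLiu418.K2LiuGL2GodementFiniteAdelicShell (exists_finiteAdelic_schwartzBruhat_of_flat)

namespace Summit.HodgeConjecture.HodgeConjecture.Cruxes.HLiu418.K2LiuGL2FlatSectionFiniteData

variable {L : Type} [Field L] [NumberField L]

/-! ## §1 `ι_∞` and `ι_f`: unitary archimedean and integral finite elements of `K` -/

/-- **`ι_∞ u ∈ K`** for `u ∈ U(2, mixedSpace L)` (`Kinf 2 L = U(2, mixedSpace L)`, ★ `Kinf_eq_unitarySubgroupGL`; `K_∞ ≤ K`). [cite: BorelJacquet1979, §4.1] -/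
theorem ofInfinite_unitary_mem (u : Matrix.unitaryGroup (Fin 2) (mixedSpace L)) :
    GLn.ofInfinite 2 L ⟨(u : Matrix (Fin 2) (Fin 2) (mixedSpace L)), star (u : Matrix (Fin 2) (Fin 2) (mixedSpace L)),
        Matrix.mem_unitaryGroup_iff.1 u.2, Matrix.mem_unitaryGroup_iff'.1 u.2⟩ ∈ standardMaximalCompactGL 2 L := by
  refine map_Kinf_le_standardMaximalCompactGL (Subgroup.mem_map_of_mem _ ?_)
  rw [Kinf_eq_unitarySubgroupGL, mem_unitarySubgroupGL_iff_coe_mem_unitaryGroup]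
  exact u.2

/-- `ι_∞ u` is upper triangular when `u` is. [folklore] -/
theorem ofInfinite_unitary_apply_one_zero {u : Matrix.unitaryGroup (Fin 2) (mixedSpace L)} (h : (u : Matrix (Fin 2) (Fin 2) (mixedSpace L)) 1 0 = 0) :
    ((GLn.ofInfinite 2 L ⟨(u : Matrix (Fin 2) (Fin 2) (mixedSpace L)), star (u : Matrix (Fin 2) (Fin 2) (mixedSpace L)),
        Matrix.mem_unitaryGroup_iff.1 u.2, Matrix.mem_unitaryGroup_iff'.1 u.2⟩ : GL (Fin 2) (AdeleRing (𝓞 L) L)) :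
          Matrix (Fin 2) (Fin 2) (AdeleRing (𝓞 L) L)) 1 0 = 0 := by
  rw [GLn.coe_ofInfinite_apply]
  refine Prod.ext ?_ ?_
  · change (InfiniteAdeleRing.ringEquiv_mixedSpace L).symm ((u : Matrix (Fin 2) (Fin 2) (mixedSpace L)) 1 0) = 0
    rw [h, map_zero]
  · change (1 : Matrix (Fin 2) (Fin 2) (FiniteAdeleRing (𝓞 L) L)) 1 0 = 0
    exact Matrix.one_apply_ne (by decide)

/-- `ι_f h ∈ K` for `h ∈ GL₂(𝒪̂_L)`. [cite: BorelJacquet1979, §4.1] -/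
theorem ofFinite_mem {h : GL (Fin 2) (FiniteAdeleRing (𝓞 L) L)} (hh : h ∈ glFiniteIntegralLevel 2 L) :
    GLn.ofFinite 2 L h ∈ standardMaximalCompactGL 2 L :=
  glIntegralLevel_le_standardMaximalCompactGL (GLn.ofFinite_mem_glIntegralLevel hh)

/-- `ι_f h` is upper triangular when `h` is. [folklore] -/
theorem ofFinite_apply_one_zero {h : GL (Fin 2) (FiniteAdeleRing (𝓞 L) L)} (hh : (h : Matrix (Fin 2) (Fin 2) (FiniteAdeleRing (𝓞 L) L)) 1 0 = 0) :
    ((GLn.ofFinite 2 L h : GL (Fin 2) (AdeleRing (𝓞 L) L)) : Matrix (Fin 2) (Fin 2) (AdeleRing (𝓞 L) L)) 1 0 = 0 := by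
  rw [GLn.coe_ofFinite_apply, hh, Matrix.one_apply_ne (by decide)]
  rfl

/-! ## §2 The section of `S`-tuples into `GL₂(𝔸_L^∞)` -/

section Tuples

variable (S : Finset (HeightOneSpectrum (𝓞 L)))

/-- the family «`t_v` on `S`, `1` off `S`» is eventually (indeed off `S`) integral. [folklore] -/
theorem eventually_dite_mem_glInt (t : ∀ v : ↥S, GL (Fin 2) (v.1.adicCompletion L)) :
    ∀ᶠ v : HeightOneSpectrum (𝓞 L) in cofinite, (if h : v ∈ S then t ⟨v, h⟩ else 1 : GL (Fin 2) (v.adicCompletion L)) ∈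
      ((glInt 2 (v.adicCompletion L) : Subgroup (GL (Fin 2) (v.adicCompletion L))) : Set (GL (Fin 2) (v.adicCompletion L))) := by
  refine (S.eventually_cofinite_notMem).mono fun v hv => ?_
  rw [dif_neg hv]
  exact one_mem _

/-- the local components of the section: `(sec t)_v = t_v` on `S`, `= 1` off `S`. [folklore] -/
theorem evalAt_sec (t : ∀ v : ↥S, GL (Fin 2) (v.1.adicCompletion L)) (v : HeightOneSpectrum (𝓞 L)) :
    GLn.evalAt 2 L v ((GLn.restrictedPiEquiv 2 L).symm (RestrictedProduct.mk (fun v => if h : v ∈ S then t ⟨v, h⟩ else 1) (eventually_dite_mem_glInt S t))) =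
      if h : v ∈ S then t ⟨v, h⟩ else 1 := by
  rw [GLn.evalAt_restrictedPiEquiv_symm]
  rfl

/-- the section is multiplicative. [folklore] -/
theorem sec_mul (t t' : ∀ v : ↥S, GL (Fin 2) (v.1.adicCompletion L)) :
    (GLn.restrictedPiEquiv 2 L).symm (RestrictedProduct.mk (fun v => if h : v ∈ S then (t * t') ⟨v, h⟩ else 1) (eventually_dite_mem_glInt S (t * t'))) =
      (GLn.restrictedPiEquiv 2 L).symm (RestrictedProduct.mk (fun v => if h : v ∈ S then t ⟨v, h⟩ else 1) (eventually_dite_mem_glInt S t)) *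
        (GLn.restrictedPiEquiv 2 L).symm (RestrictedProduct.mk (fun v => if h : v ∈ S then t' ⟨v, h⟩ else 1) (eventually_dite_mem_glInt S t')) := by
  rw [← map_mul]
  congr 1
  refine RestrictedProduct.ext _ _ fun v => ?_
  rw [RestrictedProduct.mul_apply, RestrictedProduct.mk_apply, RestrictedProduct.mk_apply, RestrictedProduct.mk_apply]
  by_cases hv : v ∈ S
  · rw [dif_pos hv, dif_pos hv, dif_pos hv, Pi.mul_apply]
  · rw [dif_neg hv, dif_neg hv, dif_neg hv, one_mul]

/-- the section of an integral tuple lies in `GL₂(𝒪̂_L)`. [folklore] -/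
theorem sec_mem_glFiniteIntegralLevel {t : ∀ v : ↥S, GL (Fin 2) (v.1.adicCompletion L)} (ht : ∀ v, t v ∈ glInt 2 (v.1.adicCompletion L)) :
    (GLn.restrictedPiEquiv 2 L).symm (RestrictedProduct.mk (fun v => if h : v ∈ S then t ⟨v, h⟩ else 1) (eventually_dite_mem_glInt S t)) ∈
      glFiniteIntegralLevel 2 L := by
  rw [GLn.mem_glFiniteIntegralLevel_iff_forall_evalAt]
  intro v
  rw [evalAt_sec]
  by_cases hv : v ∈ S
  · rw [dif_pos hv]; exact ht ⟨v, hv⟩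
  · rw [dif_neg hv]; exact one_mem _

/-- an entry of a finite-adelic invertible matrix vanishes iff it vanishes at every place. [folklore] -/
theorem apply_eq_zero_of_forall_evalAt {g : GL (Fin 2) (FiniteAdeleRing (𝓞 L) L)} {i j : Fin 2}
    (h : ∀ v, ((GLn.evalAt 2 L v g : GL (Fin 2) (v.adicCompletion L)) : Matrix (Fin 2) (Fin 2) (v.adicCompletion L)) i j = 0) :
    (g : Matrix (Fin 2) (Fin 2) (FiniteAdeleRing (𝓞 L) L)) i j = 0 :=
  FiniteAdeleRing.ext L fun v => by rw [← GLn.coe_evalAt_apply]; exact (h v).trans rfl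

end Tuples

/-! ## §3 The finite-adelic coefficients and their Schwartz–Bruhat data -/

section Main

variable (B : GL (Fin 2) (AdeleRing (𝓞 L) L) → ℂ) (S : Finset (HeightOneSpectrum (𝓞 L)))
  (γ : ∀ v : HeightOneSpectrum (𝓞 L), ValuativeRel.ValueGroupWithZero (v.adicCompletion L))

/-- **left invariance**: `βf(p · k_f) = βf(k_f)` for `p, k_f ∈ GL₂(𝒪̂_L)`, `p` upper triangular (`ι_f p ∈ K` upper triangular commutes past `ι_∞ x`; `hBK`).
[cite: JacquetLanglands1970, §3] -/
theorem betaFin_borel_mul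
    (hBK : ∀ p ∈ standardMaximalCompactGL 2 L, ∀ k ∈ standardMaximalCompactGL 2 L,
      (p : Matrix (Fin 2) (Fin 2) (AdeleRing (𝓞 L) L)) 1 0 = 0 → B (p * k) = B k)
    (c : Matrix.unitaryGroup (Fin 2) (mixedSpace L) →₀ ℂ) {p kf : GL (Fin 2) (FiniteAdeleRing (𝓞 L) L)}
    (hp : p ∈ glFiniteIntegralLevel 2 L) (hp10 : (p : Matrix (Fin 2) (Fin 2) (FiniteAdeleRing (𝓞 L) L)) 1 0 = 0) (hkf : kf ∈ glFiniteIntegralLevel 2 L) :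
    (c.sum fun x a => a * B (GLn.ofInfinite 2 L ⟨(x : Matrix (Fin 2) (Fin 2) (mixedSpace L)), star (x : Matrix (Fin 2) (Fin 2) (mixedSpace L)),
        Matrix.mem_unitaryGroup_iff.1 x.2, Matrix.mem_unitaryGroup_iff'.1 x.2⟩ * GLn.ofFinite 2 L (p * kf))) =
      c.sum fun x a => a * B (GLn.ofInfinite 2 L ⟨(x : Matrix (Fin 2) (Fin 2) (mixedSpace L)), star (x : Matrix (Fin 2) (Fin 2) (mixedSpace L)),
        Matrix.mem_unitaryGroup_iff.1 x.2, Matrix.mem_unitaryGroup_iff'.1 x.2⟩ * GLn.ofFinite 2 L kf) := by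
  refine Finsupp.sum_congr fun x _ => ?_
  congr 1
  rw [map_mul, ← mul_assoc, (GLn.commute_ofInfinite_ofFinite _ p).eq, mul_assoc]
  exact hBK _ (ofFinite_mem hp) _ (Subgroup.mul_mem _ (ofInfinite_unitary_mem x) (ofFinite_mem hkf)) (ofFinite_apply_one_zero hp10)

/-- **right invariance under the level**: `βf(k_f · r) = βf(k_f)` for `k_f, r ∈ GL₂(𝒪̂_L)` with `r_v ∈ K_{γ_v}` for `v ∈ S` (`hlev`). [cite: BorelJacquet1979, §4.1] -/
theorem betaFin_mul_level
    (hlev : ∀ k ∈ standardMaximalCompactGL 2 L, ∀ r ∈ glFiniteIntegralLevel 2 L, (∀ v ∈ S, GLn.evalAt 2 L v r ∈ congruenceGL 2 (γ v)) →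
      B (k * GLn.ofFinite 2 L r) = B k)
    (c : Matrix.unitaryGroup (Fin 2) (mixedSpace L) →₀ ℂ) {kf r : GL (Fin 2) (FiniteAdeleRing (𝓞 L) L)}
    (hkf : kf ∈ glFiniteIntegralLevel 2 L) (hr : r ∈ glFiniteIntegralLevel 2 L) (hrS : ∀ v ∈ S, GLn.evalAt 2 L v r ∈ congruenceGL 2 (γ v)) :
    (c.sum fun x a => a * B (GLn.ofInfinite 2 L ⟨(x : Matrix (Fin 2) (Fin 2) (mixedSpace L)), star (x : Matrix (Fin 2) (Fin 2) (mixedSpace L)),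
        Matrix.mem_unitaryGroup_iff.1 x.2, Matrix.mem_unitaryGroup_iff'.1 x.2⟩ * GLn.ofFinite 2 L (kf * r))) =
      c.sum fun x a => a * B (GLn.ofInfinite 2 L ⟨(x : Matrix (Fin 2) (Fin 2) (mixedSpace L)), star (x : Matrix (Fin 2) (Fin 2) (mixedSpace L)),
        Matrix.mem_unitaryGroup_iff.1 x.2, Matrix.mem_unitaryGroup_iff'.1 x.2⟩ * GLn.ofFinite 2 L kf) := by
  refine Finsupp.sum_congr fun x _ => ?_
  congr 1
  rw [map_mul, ← mul_assoc]
  exact hlev _ (Subgroup.mul_mem _ (ofInfinite_unitary_mem x) (ofFinite_mem hkf)) r hr hrS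

/-- the `S`-components section of `k_f ∈ GL₂(𝒪̂_L)` differs from `k_f` by a right factor trivial on `S`, so `βf` takes the same value. [folklore] -/
theorem betaFin_sec_evalAt
    (hlev : ∀ k ∈ standardMaximalCompactGL 2 L, ∀ r ∈ glFiniteIntegralLevel 2 L, (∀ v ∈ S, GLn.evalAt 2 L v r ∈ congruenceGL 2 (γ v)) →
      B (k * GLn.ofFinite 2 L r) = B k)
    (c : Matrix.unitaryGroup (Fin 2) (mixedSpace L) →₀ ℂ) {kf : GL (Fin 2) (FiniteAdeleRing (𝓞 L) L)} (hkf : kf ∈ glFiniteIntegralLevel 2 L) :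
    (c.sum fun x a => a * B (GLn.ofInfinite 2 L ⟨(x : Matrix (Fin 2) (Fin 2) (mixedSpace L)), star (x : Matrix (Fin 2) (Fin 2) (mixedSpace L)),
        Matrix.mem_unitaryGroup_iff.1 x.2, Matrix.mem_unitaryGroup_iff'.1 x.2⟩ * GLn.ofFinite 2 L
          ((GLn.restrictedPiEquiv 2 L).symm (RestrictedProduct.mk (fun v => if h : v ∈ S then (fun w : ↥S => GLn.evalAt 2 L w.1 kf) ⟨v, h⟩ else 1)
            (eventually_dite_mem_glInt S fun w : ↥S => GLn.evalAt 2 L w.1 kf))))) =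
      c.sum fun x a => a * B (GLn.ofInfinite 2 L ⟨(x : Matrix (Fin 2) (Fin 2) (mixedSpace L)), star (x : Matrix (Fin 2) (Fin 2) (mixedSpace L)),
        Matrix.mem_unitaryGroup_iff.1 x.2, Matrix.mem_unitaryGroup_iff'.1 x.2⟩ * GLn.ofFinite 2 L kf) := by
  have hkv : ∀ v, GLn.evalAt 2 L v kf ∈ glInt 2 (v.adicCompletion L) := (GLn.mem_glFiniteIntegralLevel_iff_forall_evalAt 2 L kf).1 hkf
  have hsk := sec_mem_glFiniteIntegralLevel S (t := fun w : ↥S => GLn.evalAt 2 L w.1 kf) fun w => hkv w.1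
  have hr := Subgroup.mul_mem _ (Subgroup.inv_mem _ hsk) hkf
  have hrS : ∀ v ∈ S, GLn.evalAt 2 L v (((GLn.restrictedPiEquiv 2 L).symm (RestrictedProduct.mk
      (fun v => if h : v ∈ S then (fun w : ↥S => GLn.evalAt 2 L w.1 kf) ⟨v, h⟩ else 1)
        (eventually_dite_mem_glInt S fun w : ↥S => GLn.evalAt 2 L w.1 kf)))⁻¹ * kf) ∈ congruenceGL 2 (γ v) := by
    intro v hv
    rw [map_mul, map_inv, evalAt_sec S (fun w : ↥S => GLn.evalAt 2 L w.1 kf) v, dif_pos hv, inv_mul_cancel]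
    exact one_mem _
  have h := betaFin_mul_level B S γ hlev c hsk hr hrS
  rw [mul_inv_cancel_left] at h
  exact h.symm

/-- **THE SCHWARTZ–BRUHAT DATA OF THE FINITE-ADELIC COEFFICIENTS** (the `hfin` face of ★ (β4-iii) `exists_godement_exhaust`).  For `B : GL₂(𝔸_L) → ℂ` with
`hBK` (left invariance under upper-triangular elements of `K` on `K`) and `hlev` (right-`K′_f`-invariance on `K`, `K′_f = ∏_{v∈S} K_{γ_v} × ∏_{v∉S} GL₂(𝒪_v)`,
`0 ≠ γ_v < 1`) and any `c : U(2, mixedSpace L) →₀ ℂ`, the coefficient `βf(k_f) = Σ_x c(x) B(ι_∞ x · ι_f k_f)` has a finite-adelic Schwartz–Bruhat function `Φf` with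
`Φf(a_f · e₂ k_f) = 𝟙_D(a) · βf(k_f)` for every idele `a` and `k_f ∈ GL₂(𝒪̂_L)` — ★ (β4-i) applied to `βf` read on `S`-tuples through the section of §2.
[cite: JacquetLanglands1970, §3, §11] [cite: Bump1997, §3.7, Prop. 4.5.2] [cite: CogdellAnalyticTheory2004, §2.3] -/
theorem exists_finiteAdelic_schwartzBruhat_of_flat_combination (hγ0 : ∀ v ∈ S, γ v ≠ 0) (hγ1 : ∀ v ∈ S, γ v < 1)
    (hBK : ∀ p ∈ standardMaximalCompactGL 2 L, ∀ k ∈ standardMaximalCompactGL 2 L,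
      (p : Matrix (Fin 2) (Fin 2) (AdeleRing (𝓞 L) L)) 1 0 = 0 → B (p * k) = B k)
    (hlev : ∀ k ∈ standardMaximalCompactGL 2 L, ∀ r ∈ glFiniteIntegralLevel 2 L, (∀ v ∈ S, GLn.evalAt 2 L v r ∈ congruenceGL 2 (γ v)) →
      B (k * GLn.ofFinite 2 L r) = B k)
    (c : Matrix.unitaryGroup (Fin 2) (mixedSpace L) →₀ ℂ) :
    ∃ Φf : (Fin 2 → FiniteAdeleRing (𝓞 L) L) → ℂ, Φf ∈ SchwartzBruhat (Fin 2 → FiniteAdeleRing (𝓞 L) L) ∧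
      ∀ (a : ideleGroup L) (kf : GL (Fin 2) (FiniteAdeleRing (𝓞 L) L)), kf ∈ glFiniteIntegralLevel 2 L →
        Φf (fun l => ((a : ideleGroup L) : AdeleRing (𝓞 L) L).2 * (kf : Matrix (Fin 2) (Fin 2) (FiniteAdeleRing (𝓞 L) L)) 1 l) =
          {a : ideleGroup L | (∀ v ∈ S, Valued.v (((a : ideleGroup L) : AdeleRing (𝓞 L) L).2 v) = 1) ∧
              ∀ v, v ∉ S → Valued.v (((a : ideleGroup L) : AdeleRing (𝓞 L) L).2 v) ≤ 1}.indicator (fun _ => (1 : ℂ)) a *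
            c.sum fun x a' => a' * B (GLn.ofInfinite 2 L ⟨(x : Matrix (Fin 2) (Fin 2) (mixedSpace L)), star (x : Matrix (Fin 2) (Fin 2) (mixedSpace L)),
              Matrix.mem_unitaryGroup_iff.1 x.2, Matrix.mem_unitaryGroup_iff'.1 x.2⟩ * GLn.ofFinite 2 L kf) := by
  -- ★ (β4-i) for `β t := βf (sec t)`
  obtain ⟨Φf, hΦf, hval⟩ := exists_finiteAdelic_schwartzBruhat_of_flat S γ hγ0 hγ1
    (fun t : ∀ v : ↥S, GL (Fin 2) (v.1.adicCompletion L) => c.sum fun x a' => a' * B (GLn.ofInfinite 2 L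
      ⟨(x : Matrix (Fin 2) (Fin 2) (mixedSpace L)), star (x : Matrix (Fin 2) (Fin 2) (mixedSpace L)), Matrix.mem_unitaryGroup_iff.1 x.2,
        Matrix.mem_unitaryGroup_iff'.1 x.2⟩ * GLn.ofFinite 2 L
          ((GLn.restrictedPiEquiv 2 L).symm (RestrictedProduct.mk (fun v => if h : v ∈ S then t ⟨v, h⟩ else 1) (eventually_dite_mem_glInt S t)))))
    (fun p k hp hp10 hk => by
      rw [sec_mul]
      refine betaFin_borel_mul B hBK c (sec_mem_glFiniteIntegralLevel S hp) (apply_eq_zero_of_forall_evalAt fun v => ?_) (sec_mem_glFiniteIntegralLevel S hk)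
      rw [evalAt_sec S p v]
      by_cases hv : v ∈ S
      · rw [dif_pos hv]; exact hp10 ⟨v, hv⟩
      · rw [dif_neg hv, Units.val_one, Matrix.one_apply_ne (by decide)])
    (fun k u hk hu => by
      rw [sec_mul]
      refine betaFin_mul_level B S γ hlev c (sec_mem_glFiniteIntegralLevel S hk)
        (sec_mem_glFiniteIntegralLevel S fun v => congruenceGL_le_glInt _ (hu v)) fun v hv => ?_
      rw [evalAt_sec S u v, dif_pos hv]
      exact hu ⟨v, hv⟩)
  refine ⟨Φf, hΦf, fun a kf hkf => ?_⟩
  rw [hval a kf hkf, betaFin_sec_evalAt B S γ hlev c hkf]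

end Main

end Summit.HodgeConjecture.HodgeConjecture.Cruxes.HLiu418.K2LiuGL2FlatSectionFiniteData

end
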